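import Summits.Ventures.CertifiedArithmetic.LowPrec.GemmTieChainFamilies
import Summits.Ventures.CertifiedArithmetic.LowPrec.Directed

/-!
# Truncation chains: sequential accumulation under `roundTowardZero` and its all-`n` families

HONEST FRAMING (venture CertifiedArithmetic / cell `pub-lowprec`): certified error envelopes and
provably optimal rounding/accumulation schemes for low-precision formats under stated cost models;
every table by two implementations; no hardware or vendor claims.

`seqSumWith r x k` = sequential accumulation of `x 0, …, x k` with an arbitrary rounding
`r : ℚ → MiniFloat α` after every addition (`r = roundNE α` is `seqSum`, `r = roundTowardZero α`
is the cell's `RZ` accumulation). The chain template of `GemmTieChains.lean` holds verbatim for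
any `r`: once the accumulator holds `v` and `r (v + c) = v`, a constant tail `c` is absorbed for
every length. Under truncation the fixpoint needs no tie: any `0 < c < ulp(v)` added to `v > 0` is
lost entirely. Families of `paper/gemm.tex` (Remarks `r:RZ`, `r:RZfp16`; products of FP4 / FP6
data exact, index `k` = additions, length `n = k + 1`):
* `E2M1²→bfloat16`, `(36, 36, ¼, …)`: `ŝ ≡ 72`, ratio `(n-2)/(286+n)` (the same values as under
  round-to-nearest-even: the residue `¼` is below half an ulp);
* `E2M1²→bfloat16`, `rz128 = (36, 36, 36, 16, 9/2, ¾, …)`: `128.5` truncates to `128`, then every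
  `¾ < ulp(128) = 1` is lost: ratio `(3n-13)/(3n+499)` — `¾ = 1.5u·128` per step (`u = 2⁻⁸`);
* `E2M1²→binary16`, `(36^×14, 8, ¼, …)`: `ŝ ≡ 512`, ratio `(n-15)/(2033+n)` as under `RNE`;
* `E2M1²→binary16`, `rz1024 = (36^×28, 16, ¾, …)`: `ŝ ≡ 1024`, ratio `(3n-87)/(3n+4009)`
  (`¾ = 1.5u·1024`, `u = 2⁻¹¹`), larger than `(n-15)/(2033+n)` exactly when `n ≥ 58`;
* `E3M2²→bfloat16`, `rz256 = (256, 15/8, 15/8, …)`: ratio `15(n-1)/(2048+15(n-1)) = kθ/(1+kθ)`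
  with `θ = 1.875u` (`15/8 = 1.25·1.5` is the largest FP6 product below `ulp(256) = 2`).
Optimality of these inputs on the ranges listed in `GEMM-BOUNDS.md` is the content of the
two-implementation certificate rows, not of this file.
-/

namespace Literature.ComputerArithmetic.FloatingPoint

namespace MiniFloat

open Finset

variable {α : Format}

/-! ### Accumulation with an arbitrary rounding and the chain template -/

/-- Sequential accumulation of `x 0, …, x k`, rounding with `r` after every step. [folklore] -/
def seqSumWith (r : ℚ → MiniFloat α) (x : ℕ → ℚ) : ℕ → MiniFloat α
  | 0 => r (x 0)
  | k + 1 => r ((seqSumWith r x k).toRat + x (k + 1))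

/-- With `r = roundNE` this is the cell's `seqSum`. [folklore] -/
theorem seqSumWith_roundNE (x : ℕ → ℚ) (k : ℕ) : seqSumWith (roundNE α) x k = seqSum α x k := by
  induction k with
  | zero => rfl
  | succ k ih =>
      show roundNE α ((seqSumWith (roundNE α) x k).toRat + x (k + 1)) =
        roundNE α ((seqSum α x k).toRat + x (k + 1))
      rw [ih]

/-- STATIONARITY for any rounding: accumulator `v` after the prefix, constant tail `c`,
`r (v + c) = v` ⇒ `ŝₖ = v` for all `k ≥ m`. [folklore] -/
theorem seqSumWith_stationary (r : ℚ → MiniFloat α) (x : ℕ → ℚ) (m : ℕ) (c v : ℚ)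
    (hx : ∀ k, m < k → x k = c) (hm : (seqSumWith r x m).toRat = v) (hfix : (r (v + c)).toRat = v) :
    ∀ k, m ≤ k → (seqSumWith r x k).toRat = v := by
  intro k hk
  induction k with
  | zero =>
      obtain rfl : m = 0 := Nat.le_zero.mp hk
      exact hm
  | succ k ih =>
      rcases Nat.lt_or_eq_of_le hk with h | h
      · show (r ((seqSumWith r x k).toRat + x (k + 1))).toRat = v
        rw [ih (Nat.lt_succ_iff.mp h), hx (k + 1) h, hfix]
      · rw [← h]; exact hm

/-- THE CHAIN TEMPLATE for any rounding `r`: for every `k ≥ m`, `ŝₖ = v`,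
`Σ_{i≤k} xᵢ = S + (k-m)c`, `Σ_{i≤k} |xᵢ| = Λ + (k-m)|c|`. [folklore] -/
theorem chainWith_spec (r : ℚ → MiniFloat α) (x : ℕ → ℚ) (m : ℕ) (c v S Λ : ℚ)
    (hx : ∀ k, m < k → x k = c) (hm : (seqSumWith r x m).toRat = v) (hfix : (r (v + c)).toRat = v)
    (hS : ∑ i ∈ range (m + 1), x i = S) (hΛ : ∑ i ∈ range (m + 1), |x i| = Λ) :
    ∀ k, m ≤ k → (seqSumWith r x k).toRat = v ∧ ∑ i ∈ range (k + 1), x i = S + ((k : ℚ) - m) * c ∧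
      ∑ i ∈ range (k + 1), |x i| = Λ + ((k : ℚ) - m) * |c| := fun k hk =>
  ⟨seqSumWith_stationary r x m c v hx hm hfix k hk, sum_range_stationary x m c S hx hS k hk,
    sum_range_stationary (fun i => |x i|) m |c| Λ (fun k h => by simp [hx k h]) hΛ k hk⟩

/-- No step of the accumulation of `x 0 … x n` with rounding `r` leaves the finite range (the
cell's `FIN` regime). [folklore] -/
def InRangeWith (r : ℚ → MiniFloat α) (x : ℕ → ℚ) (n : ℕ) : Prop :=
  |x 0| ≤ α.maxRat ∧ ∀ k < n, |(seqSumWith r x k).toRat + x (k + 1)| ≤ α.maxRat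

/-- Range side condition of a chain: prefix in range and `|v + c| ≤ maxRat` ⇒ in range for every
length. [folklore] -/
theorem chainWith_inRange (r : ℚ → MiniFloat α) (x : ℕ → ℚ) (m : ℕ) (c v : ℚ)
    (hx : ∀ k, m < k → x k = c) (hm : (seqSumWith r x m).toRat = v) (hfix : (r (v + c)).toRat = v)
    (h0 : InRangeWith r x m) (hv : |v + c| ≤ α.maxRat) : ∀ k, InRangeWith r x k := by
  intro k
  refine ⟨h0.1, fun j hj => ?_⟩
  by_cases hjm : j < m
  · exact h0.2 j hjm
  · rw [seqSumWith_stationary r x m c v hx hm hfix j (not_lt.mp hjm), hx (j + 1) (by omega)]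
    exact hv

/-! ### Truncation families -/

namespace TZChain

open Format TieChain

/-- `(36, 36, 36, 16, 9/2, ¾, ¾, …)`: prefix sum `128.5` truncates to `128`. [folklore] -/
def rz128Pre : List ℚ := [36, 36, 36, 16, 9/2]

/-- The `bfloat16` truncation family at `128`. [folklore] -/
def bf16_rz128 : ℕ → ℚ := fun k => rz128Pre.getD k (3 / 4)

/-- Prefix of the `binary16` truncation family: `36^×28, 16` (exactly `1024 = 2¹⁰`). [folklore] -/
def rz1024Pre : List ℚ := List.replicate 28 36 ++ [16]

/-- `(36^×28, 16, ¾, ¾, …)` in `binary16`: every `¾ < ulp(1024) = 1` is truncated away. [folklore] -/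
def fp16_rz1024 : ℕ → ℚ := fun k => rz1024Pre.getD k (3 / 4)

/-- `(256, 15/8, 15/8, …)`: FP6 (`E3M2`) products, `15/8 < ulp(256) = 2` in `bfloat16`. [folklore] -/
def e3m2_rz256 : ℕ → ℚ := fun k => ([256] : List ℚ).getD k (15 / 8)

/-! #### Letters are products -/

/-- Every letter of `bf16_rz128` is an FP4 product. [folklore] -/
theorem bf16_rz128_mem (k : ℕ) : bf16_rz128 k ∈ piE2M1 := by
  unfold bf16_rz128
  rcases getD_mem_or rz128Pre (3 / 4) k with h | h
  · exact (by decide +kernel : ∀ a ∈ rz128Pre, a ∈ piE2M1) _ h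
  · rw [h]; decide +kernel

/-- Every letter of `fp16_rz1024` is an FP4 product. [folklore] -/
theorem fp16_rz1024_mem (k : ℕ) : fp16_rz1024 k ∈ piE2M1 := by
  unfold fp16_rz1024
  rcases getD_mem_or rz1024Pre (3 / 4) k with h | h
  · exact (by decide +kernel : ∀ a ∈ rz1024Pre, a ∈ piE2M1) _ h
  · rw [h]; decide +kernel

/-- Every letter of `e3m2_rz256` is a product of two `E3M2` values (`256 = 16·16`,
`15/8 = (5/4)·(3/2)`). [folklore] -/
theorem e3m2_rz256_isProduct (k : ℕ) :
    ∃ a b : MiniFloat Format.E3M2, a.toRat * b.toRat = e3m2_rz256 k := by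
  have h : (([256, 15 / 8] : List ℚ).all fun p => (all Format.E3M2).any fun a =>
      (all Format.E3M2).any fun b => decide (a.toRat * b.toRat = p)) = true := by decide +kernel
  have hk : e3m2_rz256 k ∈ ([256, 15 / 8] : List ℚ) := by
    unfold e3m2_rz256
    rcases getD_mem_or [256] (15 / 8) k with h' | h'
    · rw [List.mem_singleton.mp h']; simp
    · rw [h']; simp
  have hp := List.all_eq_true.mp h _ hk
  simp only [List.any_eq_true, decide_eq_true_eq] at hp
  obtain ⟨a, -, b, -, hab⟩ := hp
  exact ⟨a, b, hab⟩

/-! #### The chains -/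

/-- `(36, 36, ¼, …)` under truncation in `bfloat16`: for every `k ≥ 1`, `ŝₖ = 72`,
`sₖ = Lₖ = 72 + (k-1)/4`. [folklore] -/
theorem bf16_rz72_spec : ∀ k, 1 ≤ k → (seqSumWith (roundTowardZero BFloat16) bf16_72 k).toRat = 72 ∧
    ∑ i ∈ range (k + 1), bf16_72 i = 72 + ((k : ℚ) - 1) * (1 / 4) ∧
    ∑ i ∈ range (k + 1), |bf16_72 i| = 72 + ((k : ℚ) - 1) * (1 / 4) := by
  have h := chainWith_spec (roundTowardZero BFloat16) bf16_72 1 (1 / 4) 72 72 72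
    (getD_tail [36, 36] _ rfl) (by decide +kernel) (by decide +kernel) (by decide +kernel)
    (by decide +kernel)
  intro k hk; obtain ⟨h1, h2, h3⟩ := h k hk
  refine ⟨h1, by simpa using h2, ?_⟩
  rw [h3, abs_of_pos (by norm_num)]; push_cast; ring

/-- … and it stays in range for every length. [folklore] -/
theorem bf16_rz72_inRange : ∀ k, InRangeWith (roundTowardZero BFloat16) bf16_72 k :=
  chainWith_inRange (roundTowardZero BFloat16) bf16_72 1 (1 / 4) 72 (getD_tail [36, 36] _ rfl)
    (by decide +kernel) (by decide +kernel) (by unfold InRangeWith; decide +kernel) (by decide +kernel)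

/-- `bf16_rz128`: for every `k ≥ 4`, `ŝₖ = 128`, `sₖ = Lₖ = 257/2 + (k-4)·¾`. [folklore] -/
theorem bf16_rz128_spec : ∀ k, 4 ≤ k →
    (seqSumWith (roundTowardZero BFloat16) bf16_rz128 k).toRat = 128 ∧
    ∑ i ∈ range (k + 1), bf16_rz128 i = 257 / 2 + ((k : ℚ) - 4) * (3 / 4) ∧
    ∑ i ∈ range (k + 1), |bf16_rz128 i| = 257 / 2 + ((k : ℚ) - 4) * (3 / 4) := by
  have h := chainWith_spec (roundTowardZero BFloat16) bf16_rz128 4 (3 / 4) 128 (257 / 2) (257 / 2)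
    (getD_tail rz128Pre _ rfl) (by decide +kernel) (by decide +kernel) (by decide +kernel)
    (by decide +kernel)
  intro k hk; obtain ⟨h1, h2, h3⟩ := h k hk
  refine ⟨h1, by simpa using h2, ?_⟩
  rw [h3, abs_of_pos (by norm_num)]; push_cast; ring

/-- `bf16_rz128` stays in range for every length. [folklore] -/
theorem bf16_rz128_inRange : ∀ k, InRangeWith (roundTowardZero BFloat16) bf16_rz128 k :=
  chainWith_inRange (roundTowardZero BFloat16) bf16_rz128 4 (3 / 4) 128 (getD_tail rz128Pre _ rfl)
    (by decide +kernel) (by decide +kernel) (by unfold InRangeWith; decide +kernel) (by decide +kernel)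

/-- `fp16_512` under truncation in `binary16`: for every `k ≥ 14`, `ŝₖ = 512`,
`sₖ = Lₖ = 512 + (k-14)/4` (the same values as under round-to-nearest-even). [folklore] -/
theorem fp16_rz512_spec : ∀ k, 14 ≤ k →
    (seqSumWith (roundTowardZero Binary16) fp16_512 k).toRat = 512 ∧
    ∑ i ∈ range (k + 1), fp16_512 i = 512 + ((k : ℚ) - 14) * (1 / 4) ∧
    ∑ i ∈ range (k + 1), |fp16_512 i| = 512 + ((k : ℚ) - 14) * (1 / 4) := by
  have h := chainWith_spec (roundTowardZero Binary16) fp16_512 14 (1 / 4) 512 512 512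
    (getD_tail fp16Pre _ rfl) (by decide +kernel) (by decide +kernel) (by decide +kernel)
    (by decide +kernel)
  intro k hk; obtain ⟨h1, h2, h3⟩ := h k hk
  refine ⟨h1, by simpa using h2, ?_⟩
  rw [h3, abs_of_pos (by norm_num)]; push_cast; ring

/-- `fp16_512` stays in range under truncation for every length. [folklore] -/
theorem fp16_rz512_inRange : ∀ k, InRangeWith (roundTowardZero Binary16) fp16_512 k :=
  chainWith_inRange (roundTowardZero Binary16) fp16_512 14 (1 / 4) 512 (getD_tail fp16Pre _ rfl)
    (by decide +kernel) (by decide +kernel) (by unfold InRangeWith; decide +kernel) (by decide +kernel)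

/-- `fp16_rz1024`: for every `k ≥ 28`, `ŝₖ = 1024`, `sₖ = Lₖ = 1024 + (k-28)·¾`. [folklore] -/
theorem fp16_rz1024_spec : ∀ k, 28 ≤ k →
    (seqSumWith (roundTowardZero Binary16) fp16_rz1024 k).toRat = 1024 ∧
    ∑ i ∈ range (k + 1), fp16_rz1024 i = 1024 + ((k : ℚ) - 28) * (3 / 4) ∧
    ∑ i ∈ range (k + 1), |fp16_rz1024 i| = 1024 + ((k : ℚ) - 28) * (3 / 4) := by
  have h := chainWith_spec (roundTowardZero Binary16) fp16_rz1024 28 (3 / 4) 1024 1024 1024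
    (getD_tail rz1024Pre _ rfl) (by decide +kernel) (by decide +kernel) (by decide +kernel)
    (by decide +kernel)
  intro k hk; obtain ⟨h1, h2, h3⟩ := h k hk
  refine ⟨h1, by simpa using h2, ?_⟩
  rw [h3, abs_of_pos (by norm_num)]; push_cast; ring

/-- `fp16_rz1024` stays in range for every length. [folklore] -/
theorem fp16_rz1024_inRange : ∀ k, InRangeWith (roundTowardZero Binary16) fp16_rz1024 k :=
  chainWith_inRange (roundTowardZero Binary16) fp16_rz1024 28 (3 / 4) 1024
    (getD_tail rz1024Pre _ rfl) (by decide +kernel) (by decide +kernel)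
    (by unfold InRangeWith; decide +kernel) (by decide +kernel)

/-- `e3m2_rz256`: for every `k`, `ŝₖ = 256`, `sₖ = Lₖ = 256 + k·15/8`. [folklore] -/
theorem e3m2_rz256_spec : ∀ k, (seqSumWith (roundTowardZero BFloat16) e3m2_rz256 k).toRat = 256 ∧
    ∑ i ∈ range (k + 1), e3m2_rz256 i = 256 + (k : ℚ) * (15 / 8) ∧
    ∑ i ∈ range (k + 1), |e3m2_rz256 i| = 256 + (k : ℚ) * (15 / 8) := by
  have h := chainWith_spec (roundTowardZero BFloat16) e3m2_rz256 0 (15 / 8) 256 256 256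
    (getD_tail [256] _ rfl) (by decide +kernel) (by decide +kernel) (by decide +kernel)
    (by decide +kernel)
  intro k; obtain ⟨h1, h2, h3⟩ := h k (Nat.zero_le k)
  refine ⟨h1, by simpa using h2, ?_⟩
  rw [h3, abs_of_pos (by norm_num)]; push_cast; ring

/-- `e3m2_rz256` stays in range for every length. [folklore] -/
theorem e3m2_rz256_inRange : ∀ k, InRangeWith (roundTowardZero BFloat16) e3m2_rz256 k :=
  chainWith_inRange (roundTowardZero BFloat16) e3m2_rz256 0 (15 / 8) 256 (getD_tail [256] _ rfl)
    (by decide +kernel) (by decide +kernel) (by unfold InRangeWith; decide +kernel) (by decide +kernel)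

/-! #### The relative errors `|ŝ - s| / Σ|pᵢ|` of length `n`, ALL `n` -/

/-- Truncation at `72`, length `n ≥ 2`: ratio `(n-2)/(286+n)`. [folklore] -/
theorem bf16_rz72_ratio (n : ℕ) (hn : 2 ≤ n) :
    |(seqSumWith (roundTowardZero BFloat16) bf16_72 (n - 1)).toRat - ∑ i ∈ range n, bf16_72 i| /
      ∑ i ∈ range n, |bf16_72 i| = ((n : ℚ) - 2) / (286 + n) := by
  obtain ⟨k, rfl⟩ : ∃ k, n = k + 1 := ⟨n - 1, by omega⟩
  obtain ⟨h1, h2, h3⟩ := bf16_rz72_spec k (by omega)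
  have hk : (1 : ℚ) ≤ k := by exact_mod_cast (show 1 ≤ k by omega)
  rw [Nat.add_sub_cancel, h1, h2, h3, abs_of_nonpos (by linarith),
    div_eq_div_iff (by linarith) (by positivity)]
  push_cast; ring

/-- Truncation at `128`, length `n ≥ 5`: ratio `(3n-13)/(3n+499)`. [folklore] -/
theorem bf16_rz128_ratio (n : ℕ) (hn : 5 ≤ n) :
    |(seqSumWith (roundTowardZero BFloat16) bf16_rz128 (n - 1)).toRat - ∑ i ∈ range n, bf16_rz128 i| /
      ∑ i ∈ range n, |bf16_rz128 i| = (3 * (n : ℚ) - 13) / (3 * n + 499) := by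
  obtain ⟨k, rfl⟩ : ∃ k, n = k + 1 := ⟨n - 1, by omega⟩
  obtain ⟨h1, h2, h3⟩ := bf16_rz128_spec k (by omega)
  have hk : (4 : ℚ) ≤ k := by exact_mod_cast (show 4 ≤ k by omega)
  rw [Nat.add_sub_cancel, h1, h2, h3, abs_of_nonpos (by linarith),
    div_eq_div_iff (by linarith) (by positivity)]
  push_cast; ring

/-- Truncation at `512` in `binary16`, length `n ≥ 15`: ratio `(n-15)/(2033+n)`. [folklore] -/
theorem fp16_rz512_ratio (n : ℕ) (hn : 15 ≤ n) :
    |(seqSumWith (roundTowardZero Binary16) fp16_512 (n - 1)).toRat - ∑ i ∈ range n, fp16_512 i| /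
      ∑ i ∈ range n, |fp16_512 i| = ((n : ℚ) - 15) / (2033 + n) := by
  obtain ⟨k, rfl⟩ : ∃ k, n = k + 1 := ⟨n - 1, by omega⟩
  obtain ⟨h1, h2, h3⟩ := fp16_rz512_spec k (by omega)
  have hk : (14 : ℚ) ≤ k := by exact_mod_cast (show 14 ≤ k by omega)
  rw [Nat.add_sub_cancel, h1, h2, h3, abs_of_nonpos (by linarith),
    div_eq_div_iff (by linarith) (by positivity)]
  push_cast; ring

/-- Truncation at `1024` in `binary16`, length `n ≥ 29`: ratio `(3n-87)/(3n+4009)`. [folklore] -/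
theorem fp16_rz1024_ratio (n : ℕ) (hn : 29 ≤ n) :
    |(seqSumWith (roundTowardZero Binary16) fp16_rz1024 (n - 1)).toRat -
        ∑ i ∈ range n, fp16_rz1024 i| / ∑ i ∈ range n, |fp16_rz1024 i| =
      (3 * (n : ℚ) - 87) / (3 * n + 4009) := by
  obtain ⟨k, rfl⟩ : ∃ k, n = k + 1 := ⟨n - 1, by omega⟩
  obtain ⟨h1, h2, h3⟩ := fp16_rz1024_spec k (by omega)
  have hk : (28 : ℚ) ≤ k := by exact_mod_cast (show 28 ≤ k by omega)
  rw [Nat.add_sub_cancel, h1, h2, h3, abs_of_nonpos (by linarith),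
    div_eq_div_iff (by linarith) (by positivity)]
  push_cast; ring

/-- FP6 truncation chain at `256`, every length `n ≥ 1`: ratio `15(n-1)/(15(n-1)+2048)`
(`= kθ/(1+kθ)`, `θ = (15/8)/256 = 1.875u`). [folklore] -/
theorem e3m2_rz256_ratio (n : ℕ) (hn : 1 ≤ n) :
    |(seqSumWith (roundTowardZero BFloat16) e3m2_rz256 (n - 1)).toRat -
        ∑ i ∈ range n, e3m2_rz256 i| / ∑ i ∈ range n, |e3m2_rz256 i| =
      (15 * ((n : ℚ) - 1)) / (15 * (n - 1) + 2048) := by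
  obtain ⟨k, rfl⟩ : ∃ k, n = k + 1 := ⟨n - 1, by omega⟩
  obtain ⟨h1, h2, h3⟩ := e3m2_rz256_spec k
  have hk : (0 : ℚ) ≤ k := by positivity
  rw [Nat.add_sub_cancel, h1, h2, h3, abs_of_nonpos (by linarith),
    div_eq_div_iff (by linarith) (by push_cast; linarith)]
  push_cast; ring

/-- The two `binary16` truncation pieces meet exactly at `n = 57` (both `21/1045`) and the
`1024`-chain leads strictly from `n = 58`: `(n-15)/(2033+n) < (3n-87)/(3n+4009) ↔ 57 < n`
(for `n ≥ 29`). [folklore] -/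
theorem fp16_rz_crossover (n : ℚ) (hn : 29 ≤ n) :
    ((n - 15) / (2033 + n) < (3 * n - 87) / (3 * n + 4009) ↔ 57 < n) := by
  rw [div_lt_div_iff₀ (by linarith) (by linarith)]
  constructor <;> intro h <;> nlinarith

end TZChain

end MiniFloat

end Literature.ComputerArithmetic.FloatingPoint
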